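import Summits.AtomisticToContinuum.Crystallization.Theorems.FrustratedLawDichotomyCellF1Row

/-!
# FrustratedLawDichotomy · crux `AperiodicFrustratedLawGap` (stmt-AtomisticToContinuum-27623) — class-A K-file skeleton, layer 3c:
the F1 NASH row from representatives on the NAMED column (decomp-a2c hand-2 g47, structural share; (272) §5 + ed2c §3″ rule G5)

`…CellF1Symm.nn_of_reps_F1` pre-wires the eight symmetry hypotheses of (272) `nn_of_reps` for F1 with the template written as a lambda; by rule G5
the «Near» file must pass NAMED columns.  ★ `nn_of_reps_aF1` is the same row on `aF1` (layer 2g) with the multiplier column a binder `ω` (the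
«Near»/«Omega» file's named table): only `hω` (equivariance of `ω` under `Stab16` on `MIF1`), the representative set (`Reps ⊆ MF1`, `rep16 m ∈ Reps`
on the near list), and the per-representative readings `hrep` over `BF1` remain.-/

namespace Summit.AtomisticToContinuum.Crystallization.Theorems.FrustratedLawDichotomyCellF1NashRow

open scoped BigOperators
open Summit.AtomisticToContinuum.Crystallization.Theorems.ChargedEnergyGapNegative (E3)
open Summit.AtomisticToContinuum.Crystallization.Theorems.FrustratedLawDichotomyCoherentFloorAlgebra (psiT)
open Summit.AtomisticToContinuum.Crystallization.Theorems.FrustratedLawDichotomyCellTails (certCoeffNearL)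
open Summit.AtomisticToContinuum.Crystallization.Theorems.FrustratedLawDichotomyCellMetric (posL)
open Summit.AtomisticToContinuum.Crystallization.Theorems.FrustratedLawDichotomyCellClasses (ballL)
open Summit.AtomisticToContinuum.Crystallization.Theorems.FrustratedLawDichotomyCellTriples (zT)
open Summit.AtomisticToContinuum.Crystallization.Theorems.FrustratedLawDichotomyCellSymm (nn_of_reps)
open Summit.AtomisticToContinuum.Crystallization.Theorems.FrustratedLawDichotomyCellSymmZ3 (actZ)
open Summit.AtomisticToContinuum.Crystallization.Theorems.FrustratedLawDichotomyCellStab16 (RZ Rr rep16 symOf16 act_inj)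
open Summit.AtomisticToContinuum.Crystallization.Theorems.FrustratedLawDichotomyCellF1Labels (MF1 MIF1 MI_subset_M hM hMI)
open Summit.AtomisticToContinuum.Crystallization.Theorems.FrustratedLawDichotomyCellF1Reps (hcov_of_subset)
open Summit.AtomisticToContinuum.Crystallization.Theorems.FrustratedLawDichotomyCellF1Symm (BF1 hB_F1 hnb_F1)
open Summit.AtomisticToContinuum.Crystallization.Theorems.FrustratedLawDichotomyCellF1Pos (aF1 ha_aF1)

/-- ★ THE F1 NASH ROW FROM REPRESENTATIVES on the named column `aF1` (rule G5): near list `nb := ballL MF1 zT ℓn`, multiplier column `ω` a binder. -/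
theorem nn_of_reps_aF1 (ω : ℤ × ℤ × ℤ → Fin 3 → ℝ) (hω : ∀ k : Fin 16, ∀ x ∈ MIF1, ω (actZ (RZ k) x) = (Rr k).mulVec (ω x))
    (ℓn : ℤ) {MN Reps : Finset (ℤ × ℤ × ℤ)} (hReps : Reps ⊆ MF1) (hR : ∀ m ∈ MN, rep16 m ∈ Reps) (nnTab : ℤ × ℤ × ℤ → ℝ)
    (hrep : ∀ F ∈ BF1, ∀ m₀ ∈ Reps, ‖psiT (‖posL F (aF1 m₀)‖ ^ 2) • posL F (aF1 m₀)
        - certCoeffNearL MF1 MIF1 (fun x => posL F (aF1 x)) (fun x => posL F (ω x)) (ballL MF1 zT ℓn) m₀‖ ≤ nnTab m₀) :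
    ∀ F ∈ BF1, ∀ m ∈ MN, ‖psiT (‖posL F (aF1 m)‖ ^ 2) • posL F (aF1 m)
        - certCoeffNearL MF1 MIF1 (fun x => posL F (aF1 x)) (fun x => posL F (ω x)) (ballL MF1 zT ℓn) m‖ ≤ nnTab (rep16 m) :=
  nn_of_reps (B := BF1) (Rr := Rr) (Pk := fun k => actZ (RZ k)) (a := aF1) (ω := ω) (symOf := symOf16)
    hB_F1 act_inj hM hMI MI_subset_M (hnb_F1 ℓn) ha_aF1 hω hReps (hcov_of_subset hR) nnTab hrep

end Summit.AtomisticToContinuum.Crystallization.Theorems.FrustratedLawDichotomyCellF1NashRow
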